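import Summits.AtomisticToContinuum.FouriersLaw.Theses.HoelderEscapeProfile
import Summits.AtomisticToContinuum.FouriersLaw.Theorems.HoelderEscapeProfileFibreCalculus
import Literature.Analysis.Fourier.CosineSeriesOrthogonality

/-!
# `CornerNoDip` (stmt-AtomisticToContinuum-16009), line `heatprofile`: stub `stub_bochnerEnvelope`

The BOCHNER ENVELOPE of the Abel heating profile of the infinite pinned quartic chain: in the crux's
frame (`μ` a shift- and momentum-reversal-invariant Gibbs state of `pinnedChain ω₂ lam β γ` at
temperature `T`, `D` an infinite-volume dynamics preserving `μ`, `h` the split-bond site energy,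
`S x t = Cov_μ(h_0, h_x ∘ φ_t)` the heating profile, `Sb ν x = ν ∫₀^∞ e^{-νt} S x t dt` its Abel mean)
`|Sb ν x| ≤ Sb ν 0` for every `ν > 0` and every site `x`.

Proof.  Three inputs.
* From the landed route item `FibreCalculus` (`FibreCalculusSketch.fibreCalculus_proof`): clause 4,
  `Σ_x (1+x²)|Sb ν x| < ∞` (so `x ↦ Sb ν x` is `ℓ¹`), and clause 8, BOCHNER POSITIVITY
  `f̂_ν(k) = Σ_x cos(kx) Sb ν x ≥ 0`.
* EVENNESS `Sb ν (−x) = Sb ν x`, from `S(−x,t) = S(x,t)`: by RIGIDITY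
  (`HeatVarianceCalculus.CanonicalRigidity.flow_ae_eq_canonical`) the guarded `D` is a.e. the canonical
  Buttà–Marchioro dynamics `D♭` (`exists_bmDynamics`: carrier `𝒳₀`, identity off `𝒳₀`, everywhere
  shift covariance `flow_chainShift_of_eq_id`, everywhere reversibility `flow_chainReversal_of_eq_id`,
  everywhere group law), so `S` may be computed with `D♭`; then
  `S(−x,t) = Cov(h_x, h_0∘φ_t)` (shift invariance of `μ`, `h_0∘τ_x = h_x`)
  `= Cov(h_x∘φ_{−t}, h_0)` (stationarity + group law, `tic_integral_mul_comp_flow_eq`)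
  `= Cov(h_x∘φ_t, h_0) = S(x,t)` (momentum reversal: `μ∘R⁻¹ = μ`, `h∘R = h`, `φ_{−t}∘R = R∘φ_t`).
* FOURIER INVERSION on the circle (`Literature.Analysis.Fourier.CosineSeriesOrthogonality`): for an
  `ℓ¹` sequence `c`, `∫_{−π}^{π} cos(kx) ĉ(k) dk = π(c_{−x} + c_x)` (product-to-sum, re-indexing, Parseval
  at zero `integral_tsum_cos_mul_eq`), hence for even `c` with `ĉ ≥ 0`:
  `2π|c_x| = |∫ cos(kx) ĉ| ≤ ∫ ĉ = 2π c_0`.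
-/

noncomputable section

open Filter Topology Set MeasureTheory

namespace Summit.AtomisticToContinuum.FouriersLaw.Theorems.CornerNoDip.HeatProfile

open Literature.MathematicalPhysics.KineticTheory.HeatConduction
open Literature.Analysis.Fourier

/-! ### Fourier inversion on the circle for `ℓ¹` cosine series -/

/-- The cosine series `k ↦ Σ_y cos(ky) c_y` of an absolutely summable sequence is continuous. [folklore] -/
theorem be_continuous_tsum_cos_mul (c : ℤ → ℝ) (hc : Summable fun y : ℤ => |c y|) :
    Continuous fun k : ℝ => ∑' y : ℤ, Real.cos (k * (y : ℝ)) * c y :=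
  continuous_tsum
    (fun y => (Real.continuous_cos.comp (continuous_id.mul continuous_const)).mul continuous_const) hc
    fun y k => by
      rw [Real.norm_eq_abs, abs_mul]
      exact mul_le_of_le_one_left (abs_nonneg _) (Real.abs_cos_le_one _)

/-- Product-to-sum under the cosine series:
`cos(kx) Σ_y cos(ky) c_y = ½ Σ_z cos(kz) c_{z−x} + ½ Σ_z cos(kz) c_{z+x}` for absolutely summable `c`.
[folklore] -/
theorem be_cos_mul_tsum_cos_mul (c : ℤ → ℝ) (hc : Summable fun y : ℤ => |c y|) (x : ℤ) (k : ℝ) :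
    Real.cos (k * (x : ℝ)) * ∑' y : ℤ, Real.cos (k * (y : ℝ)) * c y =
      (∑' z : ℤ, Real.cos (k * (z : ℝ)) * c (z - x)) / 2 +
        (∑' z : ℤ, Real.cos (k * (z : ℝ)) * c (z + x)) / 2 := by
  have hbd : ∀ (w : ℤ → ℝ) (y : ℤ), ‖Real.cos (w y) * c y‖ ≤ |c y| := fun w y => by
    rw [Real.norm_eq_abs, abs_mul]
    exact mul_le_of_le_one_left (abs_nonneg _) (Real.abs_cos_le_one _)
  have hA : Summable fun y : ℤ => Real.cos (k * ((y : ℝ) + x)) * c y :=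
    Summable.of_norm_bounded hc (hbd fun y : ℤ => k * ((y : ℝ) + x))
  have hB : Summable fun y : ℤ => Real.cos (k * ((y : ℝ) - x)) * c y :=
    Summable.of_norm_bounded hc (hbd fun y : ℤ => k * ((y : ℝ) - x))
  have e1 : ∑' z : ℤ, Real.cos (k * (z : ℝ)) * c (z - x) =
      ∑' y : ℤ, Real.cos (k * ((y : ℝ) + x)) * c y := by
    rw [← (Equiv.addRight x).tsum_eq (fun z : ℤ => Real.cos (k * (z : ℝ)) * c (z - x))]
    refine tsum_congr fun y => ?_
    simp only [Equiv.coe_addRight, add_sub_cancel_right, Int.cast_add]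
  have e2 : ∑' z : ℤ, Real.cos (k * (z : ℝ)) * c (z + x) =
      ∑' y : ℤ, Real.cos (k * ((y : ℝ) - x)) * c y := by
    rw [← (Equiv.subRight x).tsum_eq (fun z : ℤ => Real.cos (k * (z : ℝ)) * c (z + x))]
    refine tsum_congr fun y => ?_
    simp only [Equiv.subRight_apply, sub_add_cancel, Int.cast_sub]
  rw [e1, e2, ← tsum_mul_left, ← tsum_div_const, ← tsum_div_const,
    ← (hA.div_const 2).tsum_add (hB.div_const 2)]
  refine tsum_congr fun y => ?_
  rw [mul_add, mul_sub, Real.cos_add, Real.cos_sub]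
  ring

/-- `∫_{−π}^{π} cos(kx) (Σ_y cos(ky) c_y) dk = π (c_{−x} + c_x)` for absolutely summable `c : ℤ → ℝ`
(orthogonality of the lattice cosine modes). [folklore] -/
theorem be_integral_cos_mul_tsum_cos_mul (c : ℤ → ℝ) (hc : Summable fun y : ℤ => |c y|) (x : ℤ) :
    ∫ k in (-Real.pi)..Real.pi, Real.cos (k * (x : ℝ)) * ∑' y : ℤ, Real.cos (k * (y : ℝ)) * c y =
      Real.pi * (c (-x) + c x) := by
  have hc1 : Summable fun z : ℤ => |c (z - x)| := (Equiv.subRight x).summable_iff.2 hc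
  have hc2 : Summable fun z : ℤ => |c (z + x)| := (Equiv.addRight x).summable_iff.2 hc
  simp only [be_cos_mul_tsum_cos_mul c hc x]
  rw [intervalIntegral.integral_add, intervalIntegral.integral_div, intervalIntegral.integral_div,
    integral_tsum_cos_mul_eq _ hc1, integral_tsum_cos_mul_eq _ hc2]
  · simp only [zero_sub, zero_add]; ring
  · exact ((be_continuous_tsum_cos_mul _ hc1).div_const 2).intervalIntegrable _ _
  · exact ((be_continuous_tsum_cos_mul _ hc2).div_const 2).intervalIntegrable _ _

/-- **Bochner envelope on `ℤ`.** An even absolutely summable sequence whose cosine transform is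
non-negative is bounded by its value at the origin: `|c_x| ≤ c_0` (Fourier inversion on the circle,
`2π c_x = ∫ cos(kx) ĉ(k) dk`, `|cos| ≤ 1`, `ĉ ≥ 0`, `∫ ĉ = 2π c_0`). [folklore] -/
theorem be_abs_le_of_even_of_tsum_cos_nonneg {c : ℤ → ℝ} (hc : Summable fun y : ℤ => |c y|)
    (heven : ∀ y : ℤ, c (-y) = c y) (hpos : ∀ k : ℝ, 0 ≤ ∑' y : ℤ, Real.cos (k * (y : ℝ)) * c y)
    (x : ℤ) : |c x| ≤ c 0 := by
  have hπ : -Real.pi ≤ Real.pi := by linarith [Real.pi_pos]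
  have hF := be_continuous_tsum_cos_mul c hc
  have h1 : ∫ k in (-Real.pi)..Real.pi, Real.cos (k * (x : ℝ)) * ∑' y : ℤ, Real.cos (k * (y : ℝ)) * c y =
      2 * Real.pi * c x := by
    rw [be_integral_cos_mul_tsum_cos_mul c hc x, heven x]; ring
  have h2 : |∫ k in (-Real.pi)..Real.pi, Real.cos (k * (x : ℝ)) * ∑' y : ℤ, Real.cos (k * (y : ℝ)) * c y| ≤
      ∫ k in (-Real.pi)..Real.pi, ∑' y : ℤ, Real.cos (k * (y : ℝ)) * c y := by
    refine (intervalIntegral.abs_integral_le_integral_abs hπ).trans ?_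
    refine intervalIntegral.integral_mono_on hπ ?_ (hF.intervalIntegrable _ _) fun k _ => ?_
    · exact ((Real.continuous_cos.comp (continuous_id.mul continuous_const)).mul hF).abs.intervalIntegrable _ _
    · rw [abs_mul, abs_of_nonneg (hpos k)]
      exact mul_le_of_le_one_left (hpos k) (Real.abs_cos_le_one _)
  rw [h1, integral_tsum_cos_mul_eq c hc, abs_mul, abs_of_pos (by positivity : (0:ℝ) < 2 * Real.pi)] at h2
  exact le_of_mul_le_mul_left h2 (by positivity)

/-! ### Evenness of the heating profile in the site -/

/-- **The heating profile is even in the site.** For a chain with measurable `U, V ≥ 0`, a dynamics with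
carrier `𝒳₀` whose flow is measurable and the identity off `𝒳₀`, preserving a shift-invariant and
momentum-reversal-invariant measure `μ`, and any centring constant `m`:
`∫ (h_0 − m)(h_{−x}∘φ_t − m) dμ = ∫ (h_0 − m)(h_x∘φ_t − m) dμ`. Route: shift by `τ_x`
(`h_y∘τ_x = h_{y+x}`, `φ_t∘τ_x = τ_x∘φ_t`), stationarity with the group law
(`∫ f (g∘φ_t) = ∫ (f∘φ_{−t}) g`), and momentum reversal (`h∘R = h`, `φ_{−t}∘R = R∘φ_t`). [folklore] -/
theorem be_integral_centred_energyDensityZ_mul_flow_neg {P : OscillatorChain} (D : InfiniteChainDynamics P)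
    {μ : Measure ChainConfig} (hD : D.PreservesMeasure μ) (hcar : D.carrier = P.bmGood)
    (hmeas : ∀ t : ℝ, Measurable (D.flow t))
    (hid : ∀ (t : ℝ) (σ : ChainConfig), σ ∉ P.bmGood → D.flow t σ = σ)
    (hU0 : ∀ r, 0 ≤ P.U r) (hV0 : ∀ r, 0 ≤ P.V r) (hUm : Measurable P.U) (hVm : Measurable P.V)
    (hSI : IsShiftInvariant μ) (hR : MeasurePreserving chainReversal μ μ) (m : ℝ) (x : ℤ) (t : ℝ) :
    ∫ σ, (P.energyDensityZ σ 0 - m) * (P.energyDensityZ (D.flow t σ) (-x) - m) ∂μ =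
      ∫ σ, (P.energyDensityZ σ 0 - m) * (P.energyDensityZ (D.flow t σ) x - m) ∂μ := by
  have hhm : ∀ y : ℤ, Measurable fun σ : ChainConfig => P.energyDensityZ σ y - m := fun y =>
    (P.measurable_energyDensityZ hUm hVm y).sub_const m
  -- shift by `τ_x`
  have h1 : ∫ σ, (P.energyDensityZ σ 0 - m) * (P.energyDensityZ (D.flow t σ) (-x) - m) ∂μ =
      ∫ σ, (P.energyDensityZ σ x - m) * (P.energyDensityZ (D.flow t σ) 0 - m) ∂μ := by
    have hF : Measurable fun σ : ChainConfig =>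
        (P.energyDensityZ σ 0 - m) * (P.energyDensityZ (D.flow t σ) (-x) - m) :=
      (hhm 0).mul ((hhm (-x)).comp (hmeas t))
    have h := integral_comp_eq_of_measurePreserving (hSI.measurePreserving_chainShift x) hF
    beta_reduce at h
    rw [← h]
    refine integral_congr_ae (Eventually.of_forall fun σ => ?_)
    simp only [D.flow_chainShift_of_eq_id hcar hid hU0 hV0, OscillatorChain.energyDensityZ_chainShift,
      zero_add, neg_add_cancel]
  -- stationarity with the everywhere group law
  have h2 : ∫ σ, (P.energyDensityZ σ x - m) * (P.energyDensityZ (D.flow t σ) 0 - m) ∂μ =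
      ∫ σ, (P.energyDensityZ (D.flow (-t) σ) x - m) * (P.energyDensityZ σ 0 - m) ∂μ :=
    FibreCalculusSketch.tic_integral_mul_comp_flow_eq D hD hcar hid (hhm x) (hhm 0) t
  -- momentum reversal
  have h3 : ∫ σ, (P.energyDensityZ (D.flow (-t) σ) x - m) * (P.energyDensityZ σ 0 - m) ∂μ =
      ∫ σ, (P.energyDensityZ (D.flow t σ) x - m) * (P.energyDensityZ σ 0 - m) ∂μ := by
    have hF : Measurable fun σ : ChainConfig =>
        (P.energyDensityZ (D.flow (-t) σ) x - m) * (P.energyDensityZ σ 0 - m) :=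
      ((hhm x).comp (hmeas (-t))).mul (hhm 0)
    have h := integral_comp_eq_of_measurePreserving hR hF
    beta_reduce at h
    rw [← h]
    refine integral_congr_ae (Eventually.of_forall fun σ => ?_)
    simp only [D.flow_chainReversal_of_eq_id hcar hid, neg_neg, OscillatorChain.energyDensityZ_chainReversal]
  rw [h1, h2, h3]
  exact integral_congr_ae (Eventually.of_forall fun σ => mul_comm _ _)

/-! ### The stub -/

/-- **Bochner envelope of the Abel heating profile** (stub `stub_bochnerEnvelope` of line `heatprofile`
for crux `CornerNoDip`, stmt-AtomisticToContinuum-16009).  In the crux's frame — `ω₂, lam, β > 0`, any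
`γ`, `T > 0`, `μ` a `T`-Gibbs state of `pinnedChain ω₂ lam β γ`, shift-invariant and momentum-reversal
invariant, `D : InfiniteChainDynamics` preserving `μ` with shift-covariant flow, `h` the split-bond site
energy, `S x t = Cov_μ(h_0, h_x ∘ φ_t)` the heating profile and `Sb ν x = ν ∫_{(0,∞)} e^{-νt} S x t dt`
its Abel mean — `|Sb ν x| ≤ Sb ν 0` for every `ν > 0` and every `x`.  The sequence `x ↦ Sb ν x` is
`ℓ¹` and positive-definite in the cosine sense (clauses 4 and 8 of the landed `FibreCalculus`,
`FibreCalculusSketch.fibreCalculus_proof`) and even (shift invariance + stationarity + momentum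
reversal, computed along the canonical dynamics by rigidity), so Fourier inversion on the circle bounds
it by its value at the origin. [cite: Helfand1960] [cite: BonettoLebowitzReyBellet2000, §7 eq. (37)] -/
theorem stub_bochnerEnvelope :
    ∀ ω₂ lam β γ : ℝ, 0 < ω₂ → 0 < lam → 0 < β → ∀ T : ℝ, 0 < T →
      ∀ μ : Measure ChainConfig, (pinnedChain ω₂ lam β γ).IsChainGibbsMeasure T μ → IsShiftInvariant μ →
        μ.map (fun σ : ChainConfig => fun x : ℤ => ((σ x).1, -(σ x).2)) = μ →
          ∀ D : InfiniteChainDynamics (pinnedChain ω₂ lam β γ), D.PreservesMeasure μ →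
            (∀ t : ℝ, ∀ᵐ σ ∂μ, D.flow t (shift σ) = shift (D.flow t σ)) →
              ∀ h : ChainConfig → ℤ → ℝ, h = (fun (σ : ChainConfig) (x : ℤ) =>
                  (σ x).2 ^ 2 / 2 + (pinnedChain ω₂ lam β γ).U (σ x).1 +
                    ((pinnedChain ω₂ lam β γ).V ((σ (x + 1)).1 - (σ x).1) +
                      (pinnedChain ω₂ lam β γ).V ((σ x).1 - (σ (x - 1)).1)) / 2) →
                ∀ S : ℤ → ℝ → ℝ, S = (fun (x : ℤ) (t : ℝ) =>
                    ∫ σ, (h σ 0 - ∫ σ', h σ' 0 ∂μ) * (h (D.flow t σ) x - ∫ σ', h σ' 0 ∂μ) ∂μ) →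
                  ∀ Sb : ℝ → ℤ → ℝ, Sb = (fun (ν : ℝ) (x : ℤ) =>
                      ν * ∫ t in Set.Ioi (0:ℝ), Real.exp (-(ν * t)) * S x t) →
                    ∀ ν : ℝ, 0 < ν → ∀ x : ℤ, |Sb ν x| ≤ Sb ν 0 := by
  intro ω₂ lam β γ hω hl hβ T hT μ hG hSI hRefl D hP hShift h hh S hS Sb hSb ν hν x
  /- the fibre calculus of the route: clause 4 (weighted summability) and clause 8 (Bochner positivity) -/
  obtain ⟨fh, hfh⟩ : ∃ fh : ℝ → ℝ → ℝ, fh = fun (ν k : ℝ) => ∑' x : ℤ, Real.cos (k * (x : ℝ)) * Sb ν x :=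
    ⟨_, rfl⟩
  obtain ⟨-, -, -, h4, -, -, -, h8, -⟩ :=
    FibreCalculusSketch.fibreCalculus_proof ω₂ lam β γ hω hl hβ T hT μ hG hSI hRefl D hP hShift h hh S hS
      Sb hSb _ rfl _ rfl fh hfh _ rfl
  have hc : Summable fun y : ℤ => |Sb ν y| :=
    Literature.Analysis.Asymptotics.summable_abs_of_weighted_summable (h4 ν hν)
  have hpos : ∀ k : ℝ, 0 ≤ ∑' y : ℤ, Real.cos (k * (y : ℝ)) * Sb ν y := fun k => by
    have h0 := h8 ν hν k
    rw [hfh] at h0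
    exact h0
  /- chain data, the canonical dynamics `D♭`, rigidity -/
  have hss : (pinnedChain ω₂ lam β γ).HasSuperstabilityEstimate μ :=
    OscillatorChain.hasSuperstabilityEstimate_of_isShiftInvariant_pinnedChain γ hω hl.le hβ.le hT hG hSI
  have hU0 : ∀ q : ℝ, 0 ≤ (pinnedChain ω₂ lam β γ).U q := OscillatorChain.pinnedChain_U_nonneg β γ hω.le hl.le
  have hV0 : ∀ r : ℝ, 0 ≤ (pinnedChain ω₂ lam β γ).V r := OscillatorChain.pinnedChain_V_nonneg ω₂ lam γ hβ.le
  have hUm : Measurable (pinnedChain ω₂ lam β γ).U := OscillatorChain.measurable_pinnedChain_U ω₂ lam β γ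
  have hVm : Measurable (pinnedChain ω₂ lam β γ).V := OscillatorChain.measurable_pinnedChain_V ω₂ lam β γ
  have hU2 : OscillatorChain.IsEvenPolyOfDegree (pinnedChain ω₂ lam β γ).U 2 :=
    OscillatorChain.pinnedChain_isEvenPolyOfDegree_U β γ hω.le hl
  have hV2 : OscillatorChain.IsEvenPolyOfDegree (pinnedChain ω₂ lam β γ).V 2 :=
    OscillatorChain.pinnedChain_isEvenPolyOfDegree_V ω₂ lam γ hβ
  obtain ⟨D', hcar, hmeas, hid, -, -, -, hpresAll⟩ :=
    OscillatorChain.exists_bmDynamics (P := pinnedChain ω₂ lam β γ) one_le_two one_le_two hU2 hV2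
  have hP' : D'.PreservesMeasure μ := hpresAll T μ hG hss
  have hrig := HeatVarianceCalculus.CanonicalRigidity.flow_ae_eq_canonical γ hω hl hβ hT hG hSI D D' hP hcar
  /- `S` along `D♭`, with the energy density of the Literature and an opaque centring constant -/
  have hh' : ∀ (σ : ChainConfig) (y : ℤ), h σ y = (pinnedChain ω₂ lam β γ).energyDensityZ σ y := by
    intro σ y; subst hh; rfl
  obtain ⟨m, hm⟩ : ∃ m : ℝ, m = ∫ σ', h σ' 0 ∂μ := ⟨_, rfl⟩
  have hS' : ∀ (y : ℤ) (t : ℝ), S y t = ∫ σ, ((pinnedChain ω₂ lam β γ).energyDensityZ σ 0 - m) *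
      ((pinnedChain ω₂ lam β γ).energyDensityZ (D'.flow t σ) y - m) ∂μ := by
    intro y t
    rw [hS, ← hm]
    simp only [hh']
    refine integral_congr_ae ?_
    filter_upwards [hrig] with σ hσ
    rw [hσ t]
  /- evenness in the site -/
  have heven : ∀ y : ℤ, Sb ν (-y) = Sb ν y := by
    intro y
    have e : S (-y) = S y := by
      funext t
      rw [hS', hS']
      exact be_integral_centred_energyDensityZ_mul_flow_neg D' hP' hcar hmeas hid hU0 hV0 hUm hVm hSI
        ⟨measurable_chainReversal, hRefl⟩ m y t
    have hSb' : ∀ z : ℤ, Sb ν z = ν * ∫ t in Set.Ioi (0:ℝ), Real.exp (-(ν * t)) * S z t :=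
      fun z => congrFun (congrFun hSb ν) z
    rw [hSb', hSb', e]
  /- Fourier inversion -/
  exact be_abs_le_of_even_of_tsum_cos_nonneg hc heven hpos x

end Summit.AtomisticToContinuum.FouriersLaw.Theorems.CornerNoDip.HeatProfile

end
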